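/-
Copyright (c) 2026 the pub-hodgecm-mathlib formalisation cell (harness21).  Prover seat hodgecm-mathlib-K2E1-p10 (g2), Track B ∕ K2-LIT (build stream 29),
h413 = `stmt-HodgeConjecture-24833`, route of record `HCCMUnconditional`, campaign «5Res (b) BL-2(χ,τ)»; dealer K2E1-plan (g6) deal (105) 2026-09-04T10:54:27Z
(SHEET (93)(b) row 10, K2-defs1 (g6): «the ℓ9 scalar `ĥ(z)` becomes a holomorphic MATRIX `𝔥(z) ∈ End V` on the finite-dimensional section space `V = chiSectionSpace χ K′ ω`»).
-/
import Summits.HodgeConjecture.HodgeConjecture.Theorems.K2E1SphericalHeckeEigenSectionU2       -- ★ P5: `differentiable_integral_mul_borelHeight_cpow` (entire in z), `integral_flatSectionU_mul_mul_eq` (spherical sanity), `borelHeight_coe_pos`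
import Summits.HodgeConjecture.HodgeConjecture.Theorems.K2E1CharacterEisensteinU2Defs          -- ★ p859441 (K2-defs1 g6): `IsChiSection`, `flatSectionU_borel_mul_of_isChiSection`
import Summits.HodgeConjecture.HodgeConjecture.Theorems.K2E1BLHeckeOperatorWeightedU2           -- ★ (K2E1-p08): `exists_borelHeight_mul_le_of_isCompact` (`H(x y) ≤ κ·H(x)` for `y` in a compact set)
import Summits.HodgeConjecture.HodgeConjecture.Theorems.K2E1BorelEisensteinGodementCMTwo        -- ★ Godement CM-two `summable_borelHeight_rpow_cm_two` (`Re z > 1`)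
import Summits.HodgeConjecture.HodgeConjecture.Theorems.K2E1BorelEisensteinGodementCMThree      -- ★ Godement CM-three `summable_borelHeight_rpow_cm_three` (`Re z > 2`)
import Literature.NumberTheory.Automorphic.AdelicUnitaryGroupUnimodularQuasiSplit              -- ★ `forall_isHaarMeasure_isMulRightInvariant_quasiSplit_cm` (`U(J_N)(𝔸)` unimodular at the CM pair)
import HarnessLib

/-!
# h413 ∕ Track B «K2-LIT», campaign «5Res (b) BL-2(χ,τ)» — helper `K2E1ChiEisensteinHeckeMatrixU2` (SHEET row 10): THE HECKE MATRIX `𝔥(z) ∈ End V` OF A TEST FUNCTION `h` ON A SPACE `V`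
# OF (χ,τ)-SECTIONS — `R(h) f_z^φ = f_z^{𝔥(z)φ}` (every `z`), `𝔥(z)` ENTIRE IN `z`, and `R(h) E(f_z^φ) = E(f_z^{𝔥(z)φ})` on the Godement half-plane (`U(1,1)`: `Re z > 1`; `U(2,1)`: `Re z > 2`)

Cell `pub/hodgecm-mathlib`, crux h413 = `stmt-HodgeConjecture-24833`, route of record `HCCMUnconditional`; chair K2-lead (g1), dealer K2E1-plan (g6) deals (102)∕(105); sheet K2-defs1 (g6)
`SHEET-5Res-b-chi-twins` row 10, currency of row 9 (`chiSectionSpace χ K′ ω`, carrier `{φ | IsChiSection χ φ ∧ ∀ g (k : ↥K′), φ (g * k) = ω k * φ g}`, bus l.11624).  THEOREMS ONLY (no `def`,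
no `instance`, no notation, no named-fact hypothesis, no `sorry`); lane `--supports stmt-HodgeConjecture-24833 --as helper` (count-neutral).  Closes no socket.

THE MATHEMATICS ([BernsteinLapid2019, §4 Claim 1]; [MoeglinWaldspurger1995, I.2.17, II.1.2, II.1.7]; [Langlands1976, §6]).  For `h ∈ C_c(G(𝔸))` the right convolution `(R(h)f)(x) = ∫_G h(y) f(x y) dy`
of the flat section `f_z^φ = φ·H^z` of a section `φ` is again a flat section at the SAME exponent: `R(h) f_z^φ = f_z^{T φ}` with the TRANSPORTED SECTION
`(T_{h,z} φ)(x) := (∫_G h(y)·f_z^φ(x y) dy)·H(x)^{−z}` (§1, pure algebra since `H > 0`).  `T_{h,z}` PRESERVES `χ`-equivariance on the left (`f_z^φ(b g) = χ(b₀₀)(‖b₁₁‖⁻¹)^z f_z^φ(g)` ★ and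
`H(b x) = ‖b₁₁‖⁻¹ H(x)` ★ — the powers cancel), PRESERVES right `(K′, ω)`-equivariance when `h` is `K′`-CENTRAL (`h(k⁻¹ x k) = h(x)`: substitute `y ↦ k y k⁻¹`, Haar measure two-sided) and
`K′ ≤ K` (`H(x k) = H(x)` ★), is LINEAR in `φ` on continuous sections (`h ∈ C_c` ⇒ integrable integrands) and ENTIRE in `z` at every point (`y ↦ x⁻¹y` turns the integral into ★ ℓ9 (a)'s
`∫ h̃(y)·H(y)^z dy`, `h̃ = h(x⁻¹·)·φ ∈ C_c`).  Hence on any space `V` of continuous sections cut out by these two equivariances `T_{h,z}` IS a linear endomorphism `𝔥(z) ∈ Module.End ℂ V`,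
entrywise entire — the (χ,τ) replacement of the ℓ9 SCALAR `ĥ(z)` (spherical sanity §1: `V = ℂ·𝟙`, `h` left-`K`-invariant ⇒ `T_{h,z} 𝟙 = ĥ(z)·𝟙` by ★ `integral_flatSectionU_mul_mul_eq`).  Finally
`R(h) E(f_z^φ) = E(f_z^{T φ})` termwise, the interchange `∫Σ_q = Σ_q∫` being licensed for bounded `φ` on the Godement range by `H(x y) ≤ κ·H(x)` for `y ∈ tsupport h` (★
`exists_borelHeight_mul_le_of_isCompact`): `Σ_q ∫‖h(y) f_z^φ(γ̃_q g y)‖ ≤ M κ^{Re z} ‖h‖₁ Σ_q H(γ̃_q g)^{Re z} < ∞` — NO `K`-invariance of `h` is needed for this.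

* §1 (every rank `(F, E, c, N)`; the transported section SPELLED OUT, no `def`): `flatSectionU_rightConvSection` (`f_z^{Tφ} = R(h) f_z^φ`), **`isChiSection_rightConvSection`**,
  **`rightConvSection_mul_right`** (right `(k, ω)`-equivariance for `K′`-central `h`), `rightConvSection_add ∕ _smul`, **`differentiable_rightConvSection_apply`** (entire in `z`),
  `rightConvSection_const` (spherical sanity `T 𝟙 = ĥ(z)𝟙`), **`exists_heckeEnd`** (`∃ 𝔥 : ℂ → Module.End ℂ V` with `(𝔥 z φ : G → ℂ) = T_{h,z} φ`, `flatSectionU (𝔥 z φ) z = R(h) f_z^φ`, entrywise entire).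
* §2 (every rank, Godement range as a hypothesis; CM prints) **`integral_mul_eisensteinSeriesU_flatSectionU_eq_of_summable`** (`R(h)E(f_z^φ) = E(f_z^{Tφ})`), `…_cm_two` (`1 < Re z`), `…_cm_three`
  (`2 < Re z`), and `exists_heckeEnd_cm_two ∕ _cm_three` (two-sided Haar ★ `forall_isHaarMeasure_isMulRightInvariant_quasiSplit_cm`).

HONEST LABEL: HC_CM is proved only modulo the 7 printed citations (2 remaining named inputs: hLiu418 = `stmt-HodgeConjecture-24832`, h413 = `stmt-HodgeConjecture-24833`) until rung 0
closes; this file asserts no named fact and closes no socket.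
References: [BernsteinLapid2019] J. Bernstein, E. Lapid, *On the meromorphic continuation of Eisenstein series*, arXiv:1911.02342 (JAMS 37 (2024)), §4 Claim 1 (p. 9); [MoeglinWaldspurger1995]
C. Mœglin, J.-L. Waldspurger, *Spectral Decomposition and Eisenstein Series*, I.2.17, II.1.2, II.1.5–II.1.7; [Langlands1976] R. P. Langlands, LNM 544, §6 (p. 167); [Garrett2018] §2.8, §3.10.
-/

set_option autoImplicit false
-- the mandated namespace repeats `HodgeConjecture.HodgeConjecture`, as in every `Theorems/*.lean` of this sub-problem
set_option linter.dupNamespace false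

noncomputable section

open MeasureTheory MeasureTheory.Measure Set NumberField Filter Topology Function MulAction
open scoped NNReal ENNReal
open Literature.NumberTheory.Automorphic Literature.NumberTheory.Automorphic.UnitaryGroup AdelicGroupData
open Literature.NumberTheory.GaloisRepresentations (HeckeCharacter)
open Summit.HodgeConjecture.HodgeConjecture.Cruxes.H413.K2E1BorelEisensteinU
open Summit.HodgeConjecture.HodgeConjecture.Cruxes.H413.K2E1SphericalHeckeEigenSectionU2 (integral_flatSectionU_mul_mul_eq differentiable_integral_mul_borelHeight_cpow borelHeight_coe_pos)
open Summit.HodgeConjecture.HodgeConjecture.Cruxes.H413.K2E1CharacterEisensteinU2Defs (IsChiSection firstEntryUnit flatSectionU_borel_mul_of_isChiSection)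
open Summit.HodgeConjecture.HodgeConjecture.Cruxes.H413.K2E1BLHeckeOperatorWeightedU2 (exists_borelHeight_mul_le_of_isCompact)
open Summit.HodgeConjecture.HodgeConjecture.Cruxes.H413.K2E1BorelEisensteinGodementU (countable_borelQuotient)
open Summit.HodgeConjecture.HodgeConjecture.Cruxes.H413.K2E1BorelEisensteinGodementCMTwo (summable_borelHeight_rpow_cm_two)
open Summit.HodgeConjecture.HodgeConjecture.Cruxes.H413.K2E1BorelEisensteinGodementCMThree (summable_borelHeight_rpow_cm_three)

namespace Summit.HodgeConjecture.HodgeConjecture.Cruxes.H413.K2E1ChiEisensteinHeckeMatrixU2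

/-! ## §1 Every rank: the transported section `(T_{h,z} φ)(x) = (∫ h(y)·f_z^φ(x y) dν_G(y))·H(x)^{−z}` -/

section Generic

variable {F E : Type} [Field F] [NumberField F] [Field E] [NumberField E] [Algebra F E] {c : E ≃ₐ[F] E} {N : ℕ} [NeZero N]
  [MeasurableSpace (quasiSplit F E c N).Adelic] [BorelSpace (quasiSplit F E c N).Adelic]

omit [BorelSpace (quasiSplit F E c N).Adelic] in
/-- **`f_z^{T φ} = R(h) f_z^φ`**: the flat section of the transported section is the right convolution of the flat section, `H(x)^{−z}·H(x)^z = 1` (`H > 0`). [cite: MoeglinWaldspurger1995, II.1.2]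
[cite: BernsteinLapid2019, §4 Claim 1 (p. 9)] -/
theorem flatSectionU_rightConvSection (νG : Measure (quasiSplit F E c N).Adelic) (h φ : (quasiSplit F E c N).Adelic → ℂ) (z : ℂ) :
    flatSectionU (fun x => (∫ y, h y * flatSectionU φ z (x * y) ∂νG) * (((borelHeight x : ℝ≥0) : ℝ) : ℂ) ^ (-z)) z =
      fun x => ∫ y, h y * flatSectionU φ z (x * y) ∂νG := by
  funext x
  have hne : (((borelHeight x : ℝ≥0) : ℝ) : ℂ) ≠ 0 := Complex.ofReal_ne_zero.2 (borelHeight_coe_pos x).ne'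
  rw [flatSectionU_apply, mul_assoc, ← Complex.cpow_add _ _ hne, neg_add_cancel, Complex.cpow_zero, mul_one]

omit [BorelSpace (quasiSplit F E c N).Adelic] in
/-- **`T_{h,z}` PRESERVES `χ`-SECTIONS**: `(T φ)(b x) = χ(b₀₀)·(T φ)(x)` for `b ∈ B(𝔸_F)` — `f_z^φ(b x y) = χ(b₀₀)(‖b₁₁‖⁻¹)^z f_z^φ(x y)` (★ `flatSectionU_borel_mul_of_isChiSection`) and
`H(b x)^{−z} = (‖b₁₁‖⁻¹)^{−z} H(x)^{−z}` (★ `borelHeight_borel_mul`). [cite: MoeglinWaldspurger1995, I.2.17, II.1.2] -/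
theorem isChiSection_rightConvSection (νG : Measure (quasiSplit F E c N).Adelic) {χ : HeckeCharacter E} {φ : (quasiSplit F E c N).Adelic → ℂ} (hχφ : IsChiSection χ φ)
    (h : (quasiSplit F E c N).Adelic → ℂ) (z : ℂ) :
    IsChiSection χ (fun x => (∫ y, h y * flatSectionU φ z (x * y) ∂νG) * (((borelHeight x : ℝ≥0) : ℝ) : ℂ) ^ (-z)) := by
  intro b hb g
  set a : ℝ≥0 := (IdeleClassGroup.ideleNorm E (lastEntryUnit hb))⁻¹ with ha
  have ha0 : ((a : ℝ) : ℂ) ≠ 0 := Complex.ofReal_ne_zero.2 (NNReal.coe_pos.2 (inv_pos.2 (pos_iff_ne_zero.2 (ideleNorm_ne_zero _)))).ne'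
  have haz : ((a : ℝ) : ℂ) ^ z ≠ 0 := fun h0 => ha0 ((Complex.cpow_eq_zero_iff _ _).1 h0).1
  have e1 : ∀ y, flatSectionU φ z (b * g * y) = ((χ (firstEntryUnit hb) : ℂˣ) : ℂ) * ((a : ℝ) : ℂ) ^ z * flatSectionU φ z (g * y) := fun y => by
    rw [mul_assoc]; exact flatSectionU_borel_mul_of_isChiSection hχφ z hb (g * y)
  have e2 : (fun y => h y * flatSectionU φ z (b * g * y)) = fun y => (((χ (firstEntryUnit hb) : ℂˣ) : ℂ) * ((a : ℝ) : ℂ) ^ z) * (h y * flatSectionU φ z (g * y)) := by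
    funext y; rw [e1]; ring
  have e3 : (((borelHeight (b * g) : ℝ≥0) : ℝ) : ℂ) ^ (-z) = ((a : ℝ) : ℂ) ^ (-z) * (((borelHeight g : ℝ≥0) : ℝ) : ℂ) ^ (-z) := by
    rw [borelHeight_borel_mul hb g, NNReal.coe_mul, Complex.ofReal_mul, Complex.mul_cpow_ofReal_nonneg (NNReal.coe_nonneg _) (NNReal.coe_nonneg _)]
  have hcan : ((a : ℝ) : ℂ) ^ z * ((a : ℝ) : ℂ) ^ (-z) = 1 := by rw [Complex.cpow_neg, mul_inv_cancel₀ haz]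
  show (∫ y, h y * flatSectionU φ z (b * g * y) ∂νG) * (((borelHeight (b * g) : ℝ≥0) : ℝ) : ℂ) ^ (-z) =
    ((χ (firstEntryUnit hb) : ℂˣ) : ℂ) * ((∫ y, h y * flatSectionU φ z (g * y) ∂νG) * (((borelHeight g : ℝ≥0) : ℝ) : ℂ) ^ (-z))
  rw [e2, integral_const_mul, e3]
  linear_combination (((χ (firstEntryUnit hb) : ℂˣ) : ℂ) * (∫ y, h y * flatSectionU φ z (g * y) ∂νG) * (((borelHeight g : ℝ≥0) : ℝ) : ℂ) ^ (-z)) * hcan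

/-- **`T_{h,z}` PRESERVES RIGHT `(k, ω)`-EQUIVARIANCE FOR `K′`-CENTRAL `h`**: if `k ∈ K` (so `H(x k) = H(x)` ★), `h(k⁻¹ y k) = h(y)` for all `y`, and `φ(y k) = ω·φ(y)` for all `y`, then
`(T φ)(x k) = ω·(T φ)(x)` — substitute `y ↦ k y k⁻¹` (two-sided Haar measure `ν_G`). [cite: MoeglinWaldspurger1995, I.2.17] [cite: BernsteinLapid2019, §4 Claim 1 (p. 9)] -/
theorem rightConvSection_mul_right (νG : Measure (quasiSplit F E c N).Adelic) [νG.IsMulLeftInvariant] [νG.IsMulRightInvariant] (h φ : (quasiSplit F E c N).Adelic → ℂ) (z : ℂ)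
    {k : (quasiSplit F E c N).Adelic} (hk : k ∈ ((standardMaximalCompactGL N E).comap (adelicVal F E c N ((StdForm.antidiagonal N).over E)) : Subgroup (quasiSplit F E c N).Adelic))
    (hconj : ∀ y, h (k⁻¹ * y * k) = h y) {ω : ℂ} (hφk : ∀ y, φ (y * k) = ω * φ y) (x : (quasiSplit F E c N).Adelic) :
    (fun x => (∫ y, h y * flatSectionU φ z (x * y) ∂νG) * (((borelHeight x : ℝ≥0) : ℝ) : ℂ) ^ (-z)) (x * k) =
      ω * (fun x => (∫ y, h y * flatSectionU φ z (x * y) ∂νG) * (((borelHeight x : ℝ≥0) : ℝ) : ℂ) ^ (-z)) x := by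
  have hfk : ∀ y, flatSectionU φ z (y * k) = ω * flatSectionU φ z y := fun y => by
    rw [flatSectionU_apply, flatSectionU_apply, hφk, borelHeight_mul_of_mem_comap_standardMaximalCompactGL hk]; ring
  -- the integrand along `y ↦ k y k⁻¹`
  have e1 : (fun y => h y * flatSectionU φ z (x * k * y)) = fun y => ω * (h (k⁻¹ * (k * y * k⁻¹) * k) * flatSectionU φ z (x * (k * y * k⁻¹))) := by
    funext y
    rw [show k⁻¹ * (k * y * k⁻¹) * k = y by group, show x * k * y = x * (k * y * k⁻¹) * k by group, hfk]; ring
  -- the substitution `y ↦ k y k⁻¹` preserves `ν_G`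
  have e2 : ∫ y, h (k⁻¹ * (k * y * k⁻¹) * k) * flatSectionU φ z (x * (k * y * k⁻¹)) ∂νG = ∫ u, h (k⁻¹ * u * k) * flatSectionU φ z (x * u) ∂νG := by
    have h1 := integral_mul_right_eq_self (μ := νG) (fun y => h (k⁻¹ * (k * y) * k) * flatSectionU φ z (x * (k * y))) k⁻¹
    have h2 := integral_mul_left_eq_self (μ := νG) (fun u => h (k⁻¹ * u * k) * flatSectionU φ z (x * u)) k
    rw [← h2, ← h1]
    simp only [mul_assoc]
  dsimp only
  rw [e1, integral_const_mul, e2, borelHeight_mul_of_mem_comap_standardMaximalCompactGL hk x]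
  simp only [hconj]
  ring

/-- **`T_{h,z}` IS ADDITIVE ON CONTINUOUS SECTIONS** (`h ∈ C_c`: the integrands `h·f_z^{φ_i}(x·)` are integrable). [cite: MoeglinWaldspurger1995, II.1.2] -/
theorem rightConvSection_add (νG : Measure (quasiSplit F E c N).Adelic) [IsFiniteMeasureOnCompacts νG] {h : (quasiSplit F E c N).Adelic → ℂ} (hh : Continuous h)
    (hhs : HasCompactSupport h) {φ₁ φ₂ : (quasiSplit F E c N).Adelic → ℂ} (hφ₁ : Continuous φ₁) (hφ₂ : Continuous φ₂) (z : ℂ) :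
    (fun x => (∫ y, h y * flatSectionU (φ₁ + φ₂) z (x * y) ∂νG) * (((borelHeight x : ℝ≥0) : ℝ) : ℂ) ^ (-z)) =
      (fun x => (∫ y, h y * flatSectionU φ₁ z (x * y) ∂νG) * (((borelHeight x : ℝ≥0) : ℝ) : ℂ) ^ (-z)) +
        fun x => (∫ y, h y * flatSectionU φ₂ z (x * y) ∂νG) * (((borelHeight x : ℝ≥0) : ℝ) : ℂ) ^ (-z) := by
  funext x
  have hint : ∀ {φ : (quasiSplit F E c N).Adelic → ℂ}, Continuous φ → Integrable (fun y => h y * flatSectionU φ z (x * y)) νG := fun hφ =>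
    (hh.mul ((continuous_flatSectionU hφ z).comp (continuous_const.mul continuous_id))).integrable_of_hasCompactSupport hhs.mul_right
  have e : (fun y => h y * flatSectionU (φ₁ + φ₂) z (x * y)) = fun y => h y * flatSectionU φ₁ z (x * y) + h y * flatSectionU φ₂ z (x * y) := by
    funext y; simp only [flatSectionU_apply, Pi.add_apply]; ring
  simp only [Pi.add_apply]
  rw [e, integral_add (hint hφ₁) (hint hφ₂)]
  ring

omit [BorelSpace (quasiSplit F E c N).Adelic] in
/-- **`T_{h,z}` IS HOMOGENEOUS.** [cite: MoeglinWaldspurger1995, II.1.2] -/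
theorem rightConvSection_smul (νG : Measure (quasiSplit F E c N).Adelic) (h φ : (quasiSplit F E c N).Adelic → ℂ) (a : ℂ) (z : ℂ) :
    (fun x => (∫ y, h y * flatSectionU (a • φ) z (x * y) ∂νG) * (((borelHeight x : ℝ≥0) : ℝ) : ℂ) ^ (-z)) =
      a • fun x => (∫ y, h y * flatSectionU φ z (x * y) ∂νG) * (((borelHeight x : ℝ≥0) : ℝ) : ℂ) ^ (-z) := by
  funext x
  have e : (fun y => h y * flatSectionU (a • φ) z (x * y)) = fun y => a * (h y * flatSectionU φ z (x * y)) := by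
    funext y; simp only [flatSectionU_apply, Pi.smul_apply, smul_eq_mul]; ring
  simp only [Pi.smul_apply, smul_eq_mul]
  rw [e, integral_const_mul, mul_assoc]

/-- **`z ↦ (T_{h,z} φ)(x)` IS ENTIRE** (`h ∈ C_c`, `φ` continuous): after `y ↦ x⁻¹y` the integral is `∫ h̃(y)·H(y)^z dν_G` with `h̃ = h(x⁻¹·)·φ ∈ C_c` (★ ℓ9 (a)
`differentiable_integral_mul_borelHeight_cpow`), times the entire `H(x)^{−z}`. [cite: Langlands1976, §6 (p. 167)] [cite: BernsteinLapid2019, §4 Claim 1 (p. 9)] -/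
theorem differentiable_rightConvSection_apply (νG : Measure (quasiSplit F E c N).Adelic) [νG.IsMulLeftInvariant] [IsFiniteMeasureOnCompacts νG] {h : (quasiSplit F E c N).Adelic → ℂ}
    (hh : Continuous h) (hhs : HasCompactSupport h) {φ : (quasiSplit F E c N).Adelic → ℂ} (hφ : Continuous φ) (x : (quasiSplit F E c N).Adelic) :
    Differentiable ℂ fun z : ℂ => (∫ y, h y * flatSectionU φ z (x * y) ∂νG) * (((borelHeight x : ℝ≥0) : ℝ) : ℂ) ^ (-z) := by
  have hne : (((borelHeight x : ℝ≥0) : ℝ) : ℂ) ≠ 0 := Complex.ofReal_ne_zero.2 (borelHeight_coe_pos x).ne'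
  have e : ∀ z : ℂ, ∫ y, h y * flatSectionU φ z (x * y) ∂νG = ∫ y, (h (x⁻¹ * y) * φ y) * (((borelHeight y : ℝ≥0) : ℝ) : ℂ) ^ z ∂νG := fun z => by
    have h1 := integral_mul_left_eq_self (μ := νG) (fun y => (h (x⁻¹ * y) * φ y) * (((borelHeight y : ℝ≥0) : ℝ) : ℂ) ^ z) x
    simp only [inv_mul_cancel_left] at h1
    rw [← h1]
    exact integral_congr_ae (Eventually.of_forall fun y => by simp only [flatSectionU_apply]; ring)
  simp_rw [e]
  have hsupp : HasCompactSupport fun y => h (x⁻¹ * y) * φ y := by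
    have h0 : HasCompactSupport fun y => h (x⁻¹ * y) := by
      simpa only [Homeomorph.coe_mulLeft, Function.comp_def] using hhs.comp_homeomorph (Homeomorph.mulLeft x⁻¹)
    exact h0.mul_right
  exact (differentiable_integral_mul_borelHeight_cpow νG ((hh.comp (continuous_const.mul continuous_id)).mul hφ) hsupp).mul
    (differentiable_id.neg.const_cpow (Or.inl hne))

/-- **SPHERICAL SANITY: `T_{h,z} 𝟙 = ĥ(z)·𝟙`** for left-`K`-invariant `h` (Iwasawa `hBK`) — the ℓ9 scalar ★ `integral_flatSectionU_mul_mul_eq` (so on `V = ℂ·𝟙`, `𝔥(z) = ĥ(z)·id`).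
[cite: Langlands1976, §6 (p. 167)] -/
theorem rightConvSection_const (νG : Measure (quasiSplit F E c N).Adelic) [νG.IsMulLeftInvariant]
    (hBK : ∀ g : (quasiSplit F E c N).Adelic, ∃ b ∈ borelAdelic F E c N, ∃ k : (quasiSplit F E c N).Adelic,
      adelicVal F E c N ((StdForm.antidiagonal N).over E) k ∈ standardMaximalCompactGL N E ∧ g = b * k)
    {h : (quasiSplit F E c N).Adelic → ℂ}
    (hK : ∀ k : (quasiSplit F E c N).Adelic, adelicVal F E c N ((StdForm.antidiagonal N).over E) k ∈ standardMaximalCompactGL N E → ∀ x, h (k * x) = h x)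
    (φ₀ z : ℂ) :
    (fun x => (∫ y, h y * flatSectionU (fun _ : (quasiSplit F E c N).Adelic => φ₀) z (x * y) ∂νG) * (((borelHeight x : ℝ≥0) : ℝ) : ℂ) ^ (-z)) =
      fun _ => (∫ y, h y * (((borelHeight y : ℝ≥0) : ℝ) : ℂ) ^ z ∂νG) * φ₀ := by
  funext x
  have hne : (((borelHeight x : ℝ≥0) : ℝ) : ℂ) ≠ 0 := Complex.ofReal_ne_zero.2 (borelHeight_coe_pos x).ne'
  have h1 := integral_flatSectionU_mul_mul_eq νG hBK hK φ₀ z x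
  rw [show (fun y => h y * flatSectionU (fun _ : (quasiSplit F E c N).Adelic => φ₀) z (x * y)) =
      fun y => flatSectionU (fun _ : (quasiSplit F E c N).Adelic => φ₀) z (x * y) * h y from funext fun y => mul_comm _ _, h1, flatSectionU_apply,
    mul_assoc, mul_assoc, ← Complex.cpow_add _ _ hne, add_neg_cancel, Complex.cpow_zero, mul_one]

/-- **THE HECKE ENDOMORPHISM `𝔥(z) ∈ Module.End ℂ V`** on any space `V` of CONTINUOUS sections cut out by `χ`-equivariance on the left and `(K′, ω)`-equivariance on the right (the carrier of
row 9's `chiSectionSpace χ K′ ω`, here as the hypothesis `hV`), for `h ∈ C_c(G(𝔸))` `K′`-central and `K′ ≤ K`: `(𝔥 z φ)(x) = (T_{h,z} φ)(x)`, hence `flatSectionU (𝔥 z φ) z = R(h) f_z^φ`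
(«`R(h)` acts on the flat sections of `V` through the matrix `𝔥(z)`») and `z ↦ (𝔥 z φ)(x)` is entire for all `φ`, `x` (entrywise holomorphy).  Spherical case: `𝔥(z) = ĥ(z)·id`.
[cite: BernsteinLapid2019, §4 Claim 1 (p. 9)] [cite: MoeglinWaldspurger1995, I.2.17, II.1.7] -/
theorem exists_heckeEnd (νG : Measure (quasiSplit F E c N).Adelic) [νG.IsMulLeftInvariant] [νG.IsMulRightInvariant] [IsFiniteMeasureOnCompacts νG]
    {χ : HeckeCharacter E} {K' : Subgroup (quasiSplit F E c N).Adelic}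
    (hK' : K' ≤ ((standardMaximalCompactGL N E).comap (adelicVal F E c N ((StdForm.antidiagonal N).over E)) : Subgroup (quasiSplit F E c N).Adelic)) {ω : ↥K' → ℂ}
    (V : Submodule ℂ ((quasiSplit F E c N).Adelic → ℂ)) (hV : ∀ φ, φ ∈ V ↔ IsChiSection χ φ ∧ ∀ (g : (quasiSplit F E c N).Adelic) (k : ↥K'), φ (g * k) = ω k * φ g)
    (hVc : ∀ φ ∈ V, Continuous φ) {h : (quasiSplit F E c N).Adelic → ℂ} (hh : Continuous h) (hhs : HasCompactSupport h)
    (hconj : ∀ k : ↥K', ∀ y, h ((k : (quasiSplit F E c N).Adelic)⁻¹ * y * k) = h y) :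
    ∃ 𝔥 : ℂ → Module.End ℂ ↥V,
      (∀ (z : ℂ) (φ : ↥V), ((𝔥 z φ : ↥V) : (quasiSplit F E c N).Adelic → ℂ) =
        fun x => (∫ y, h y * flatSectionU (φ : (quasiSplit F E c N).Adelic → ℂ) z (x * y) ∂νG) * (((borelHeight x : ℝ≥0) : ℝ) : ℂ) ^ (-z)) ∧
      (∀ (z : ℂ) (φ : ↥V), flatSectionU ((𝔥 z φ : ↥V) : (quasiSplit F E c N).Adelic → ℂ) z =
        fun x => ∫ y, h y * flatSectionU (φ : (quasiSplit F E c N).Adelic → ℂ) z (x * y) ∂νG) ∧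
      (∀ (φ : ↥V) (x : (quasiSplit F E c N).Adelic), Differentiable ℂ fun z : ℂ => ((𝔥 z φ : ↥V) : (quasiSplit F E c N).Adelic → ℂ) x) := by
  -- `V` is stable under `T_{h,z}`
  have hmem : ∀ (z : ℂ) (φ : ↥V), (fun x => (∫ y, h y * flatSectionU (φ : (quasiSplit F E c N).Adelic → ℂ) z (x * y) ∂νG) * (((borelHeight x : ℝ≥0) : ℝ) : ℂ) ^ (-z)) ∈ V := by
    intro z φ
    obtain ⟨hχφ, hφk⟩ := (hV _).1 φ.2
    refine (hV _).2 ⟨isChiSection_rightConvSection νG hχφ h z, fun g k => ?_⟩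
    exact rightConvSection_mul_right νG h (φ : (quasiSplit F E c N).Adelic → ℂ) z (hK' k.2) (hconj k) (fun y => hφk y k) g
  refine ⟨fun z =>
    { toFun := fun φ => ⟨_, hmem z φ⟩
      map_add' := fun φ₁ φ₂ => Subtype.ext (by
        simp only [Submodule.coe_add]
        exact rightConvSection_add νG hh hhs (hVc _ φ₁.2) (hVc _ φ₂.2) z)
      map_smul' := fun a φ => Subtype.ext (by
        simp only [Submodule.coe_smul, RingHom.id_apply]
        exact rightConvSection_smul νG h (φ : (quasiSplit F E c N).Adelic → ℂ) a z) }, fun z φ => rfl, fun z φ => ?_, fun φ x => ?_⟩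
  · exact flatSectionU_rightConvSection νG h (φ : (quasiSplit F E c N).Adelic → ℂ) z
  · exact differentiable_rightConvSection_apply νG hh hhs (hVc _ φ.2) x

/-! ## §2 `R(h) E(f_z^φ) = E(f_z^{T φ})` on the Godement range -/

/-- **`∫ h(y)·E(f_z^φ)(g y) dν_G(y) = E(f_z^{T_{h,z}φ})(g)` WHEREVER THE GODEMENT SERIES CONVERGES** (every rank; `h ∈ C_c`, `φ` continuous with `‖φ‖ ≤ M`, `0 ≤ Re z`, `Σ_q H(γ̃_q g)^{Re z} < ∞`
for all `g`): termwise §1 `flatSectionU_rightConvSection` at `x = γ̃_q g`; the interchange `∫Σ_q = Σ_q∫` (`integral_tsum_of_summable_integral_norm`, countable `B(F)∖G(F)` ★) is licensed by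
`‖h(y) f_z^φ(γ̃_q g y)‖ ≤ ‖h(y)‖·M·(κ H(γ̃_q g))^{Re z}` for `y ∈ tsupport h` (★ `exists_borelHeight_mul_le_of_isCompact`).  NO `K`-invariance of `h` is needed.
[cite: BernsteinLapid2019, §4 Claim 1 (p. 9)] [cite: MoeglinWaldspurger1995, II.1.5, II.1.7] -/
theorem integral_mul_eisensteinSeriesU_flatSectionU_eq_of_summable (νG : Measure (quasiSplit F E c N).Adelic) [IsFiniteMeasureOnCompacts νG]
    {h : (quasiSplit F E c N).Adelic → ℂ} (hh : Continuous h) (hhs : HasCompactSupport h)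
    {φ : (quasiSplit F E c N).Adelic → ℂ} (hφc : Continuous φ) {M : ℝ} (hφM : ∀ x, ‖φ x‖ ≤ M) {z : ℂ} (hz0 : 0 ≤ z.re)
    (hsum : ∀ g : (quasiSplit F E c N).Adelic, Summable fun q : Quotient (orbitRel ↥(borelU (c : E →+* E) ((StdForm.antidiagonal N).over E)) ↥(unitaryGroupOfForm (c : E →+* E) ((StdForm.antidiagonal N).over E))) =>
      ((borelHeight ((quasiSplit F E c N).toAdelic (Quotient.out q : ↥(unitaryGroupOfForm (c : E →+* E) ((StdForm.antidiagonal N).over E))) * g) : ℝ)) ^ z.re)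
    (g : (quasiSplit F E c N).Adelic) :
    ∫ y, h y * eisensteinSeriesU (flatSectionU φ z) (g * y) ∂νG =
      eisensteinSeriesU (flatSectionU (fun x => (∫ y, h y * flatSectionU φ z (x * y) ∂νG) * (((borelHeight x : ℝ≥0) : ℝ) : ℂ) ^ (-z)) z) g := by
  haveI : Countable (Quotient (orbitRel ↥(borelU (c : E →+* E) ((StdForm.antidiagonal N).over E)) ↥(unitaryGroupOfForm (c : E →+* E) ((StdForm.antidiagonal N).over E)))) :=
    countable_borelQuotient
  have hM : 0 ≤ M := (norm_nonneg _).trans (hφM 1)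
  -- heights move boundedly under `tsupport h`
  obtain ⟨κ, hκ1, hκ⟩ := exists_borelHeight_mul_le_of_isCompact (F := F) (E := E) (c := c) (N := N) hhs.isCompact
  set f : (quasiSplit F E c N).Adelic → ℂ := flatSectionU φ z with hf
  set γ : Quotient (orbitRel ↥(borelU (c : E →+* E) ((StdForm.antidiagonal N).over E)) ↥(unitaryGroupOfForm (c : E →+* E) ((StdForm.antidiagonal N).over E))) → (quasiSplit F E c N).Adelic :=
    fun q => (quasiSplit F E c N).toAdelic (Quotient.out q : ↥(unitaryGroupOfForm (c : E →+* E) ((StdForm.antidiagonal N).over E))) with hγ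
  rw [flatSectionU_rightConvSection νG h φ z]
  simp only [eisensteinSeriesU]
  -- the integrand as a series over `B(F)∖G(F)`
  have h1 : (fun y => h y * ∑' q, f (γ q * (g * y))) = fun y => ∑' q, h y * f (γ q * g * y) := by
    funext y
    rw [← tsum_mul_left]
    exact tsum_congr fun q => by rw [mul_assoc]
  -- termwise integrability (continuous, compact support)
  have hint : ∀ q, Integrable (fun y => h y * f (γ q * g * y)) νG := fun q =>
    (hh.mul ((continuous_flatSectionU hφc z).comp (continuous_const.mul continuous_id))).integrable_of_hasCompactSupport hhs.mul_right
  -- the licence: `∫ ‖h y · f(γ̃_q g y)‖ ≤ (M κ^{Re z} ∫‖h‖)·H(γ̃_q g)^{Re z}`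
  have hpt : ∀ (x y : (quasiSplit F E c N).Adelic), ‖h y * f (x * y)‖ ≤ ‖h y‖ * (M * (((κ : ℝ)) * ((borelHeight x : ℝ))) ^ z.re) := by
    intro x y
    by_cases hy : y ∈ tsupport h
    · rw [norm_mul]
      refine mul_le_mul_of_nonneg_left ?_ (norm_nonneg _)
      rw [hf, norm_flatSectionU]
      refine mul_le_mul (hφM _) (Real.rpow_le_rpow (NNReal.coe_nonneg _) ?_ hz0) (Real.rpow_nonneg (NNReal.coe_nonneg _) _) hM
      exact_mod_cast (hκ x y hy).1
    · rw [image_eq_zero_of_notMem_tsupport hy, zero_mul, norm_zero, zero_mul]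
  have hnorm : Summable fun q => ∫ y, ‖h y * f (γ q * g * y)‖ ∂νG := by
    refine Summable.of_nonneg_of_le (fun q => integral_nonneg fun y => norm_nonneg _)
      (fun q => ?_) (((hsum g).mul_left (M * (κ : ℝ) ^ z.re * ∫ y, ‖h y‖ ∂νG)))
    have hI : Integrable (fun y => ‖h y‖ * (M * (((κ : ℝ)) * ((borelHeight (γ q * g) : ℝ))) ^ z.re)) νG :=
      ((hh.norm.integrable_of_hasCompactSupport hhs.norm).mul_const _)
    calc ∫ y, ‖h y * f (γ q * g * y)‖ ∂νG ≤ ∫ y, ‖h y‖ * (M * (((κ : ℝ)) * ((borelHeight (γ q * g) : ℝ))) ^ z.re) ∂νG :=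
          integral_mono_of_nonneg (Eventually.of_forall fun y => norm_nonneg _) hI (Eventually.of_forall fun y => hpt _ y)
      _ = M * (κ : ℝ) ^ z.re * (∫ y, ‖h y‖ ∂νG) * ((borelHeight (γ q * g) : ℝ)) ^ z.re := by
          rw [integral_mul_const, Real.mul_rpow (NNReal.coe_nonneg _) (NNReal.coe_nonneg _)]; ring
  rw [h1, ← integral_tsum_of_summable_integral_norm hint hnorm]

end Generic

/-! ## §3 The CM pair: the Godement range discharged (`U(1,1)`: `1 < Re z`; `U(2,1)`: `2 < Re z`) and two-sided Haar -/

section CM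

variable (L : Type) [Field L] [NumberField L] [IsCMField L] {N : ℕ} [NeZero N]
  [MeasurableSpace (quasiSplit (↥(maximalRealSubfield L)) L (IsCMField.complexConj L) N).Adelic] [BorelSpace (quasiSplit (↥(maximalRealSubfield L)) L (IsCMField.complexConj L) N).Adelic]

/-- **THE HECKE ENDOMORPHISM AT THE CM PAIR** (`U(J_N)(𝔸_{L⁺})` is unimodular ★, so every Haar `ν_G` is two-sided): §1 `exists_heckeEnd` for a Haar measure. [cite: BernsteinLapid2019, §4 Claim 1 (p. 9)]
[cite: MoeglinWaldspurger1995, I.2.1, I.2.17] -/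
theorem exists_heckeEnd_cm (hN : 2 ≤ N) (νG : Measure (quasiSplit (↥(maximalRealSubfield L)) L (IsCMField.complexConj L) N).Adelic) [νG.IsHaarMeasure]
    {χ : HeckeCharacter L} {K' : Subgroup (quasiSplit (↥(maximalRealSubfield L)) L (IsCMField.complexConj L) N).Adelic}
    (hK' : K' ≤ ((standardMaximalCompactGL N L).comap (adelicVal (↥(maximalRealSubfield L)) L (IsCMField.complexConj L) N ((StdForm.antidiagonal N).over L)) :
      Subgroup (quasiSplit (↥(maximalRealSubfield L)) L (IsCMField.complexConj L) N).Adelic)) {ω : ↥K' → ℂ}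
    (V : Submodule ℂ ((quasiSplit (↥(maximalRealSubfield L)) L (IsCMField.complexConj L) N).Adelic → ℂ))
    (hV : ∀ φ, φ ∈ V ↔ IsChiSection χ φ ∧ ∀ (g : (quasiSplit (↥(maximalRealSubfield L)) L (IsCMField.complexConj L) N).Adelic) (k : ↥K'), φ (g * k) = ω k * φ g)
    (hVc : ∀ φ ∈ V, Continuous φ) {h : (quasiSplit (↥(maximalRealSubfield L)) L (IsCMField.complexConj L) N).Adelic → ℂ} (hh : Continuous h) (hhs : HasCompactSupport h)
    (hconj : ∀ k : ↥K', ∀ y, h ((k : (quasiSplit (↥(maximalRealSubfield L)) L (IsCMField.complexConj L) N).Adelic)⁻¹ * y * k) = h y) :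
    ∃ 𝔥 : ℂ → Module.End ℂ ↥V,
      (∀ (z : ℂ) (φ : ↥V), ((𝔥 z φ : ↥V) : (quasiSplit (↥(maximalRealSubfield L)) L (IsCMField.complexConj L) N).Adelic → ℂ) =
        fun x => (∫ y, h y * flatSectionU (φ : (quasiSplit (↥(maximalRealSubfield L)) L (IsCMField.complexConj L) N).Adelic → ℂ) z (x * y) ∂νG) * (((borelHeight x : ℝ≥0) : ℝ) : ℂ) ^ (-z)) ∧
      (∀ (z : ℂ) (φ : ↥V), flatSectionU ((𝔥 z φ : ↥V) : (quasiSplit (↥(maximalRealSubfield L)) L (IsCMField.complexConj L) N).Adelic → ℂ) z =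
        fun x => ∫ y, h y * flatSectionU (φ : (quasiSplit (↥(maximalRealSubfield L)) L (IsCMField.complexConj L) N).Adelic → ℂ) z (x * y) ∂νG) ∧
      (∀ (φ : ↥V) (x : (quasiSplit (↥(maximalRealSubfield L)) L (IsCMField.complexConj L) N).Adelic),
        Differentiable ℂ fun z : ℂ => ((𝔥 z φ : ↥V) : (quasiSplit (↥(maximalRealSubfield L)) L (IsCMField.complexConj L) N).Adelic → ℂ) x) := by
  haveI : νG.IsMulRightInvariant := forall_isHaarMeasure_isMulRightInvariant_quasiSplit_cm L hN νG inferInstance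
  exact exists_heckeEnd νG hK' V hV hVc hh hhs hconj

/-- **`R(h) E(f_z^φ) = E(f_z^{T_{h,z}φ})` ON `U(1,1)_{L∕L⁺}` FOR `1 < Re z`** (★ Godement `summable_borelHeight_rpow_cm_two`). [cite: BernsteinLapid2019, §4 Claim 1 (p. 9)] [cite: MoeglinWaldspurger1995, II.1.5, II.1.7] -/
theorem integral_mul_eisensteinSeriesU_flatSectionU_eq_cm_two
    [MeasurableSpace (quasiSplit (↥(maximalRealSubfield L)) L (IsCMField.complexConj L) 2).Adelic] [BorelSpace (quasiSplit (↥(maximalRealSubfield L)) L (IsCMField.complexConj L) 2).Adelic]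
    (νG : Measure (quasiSplit (↥(maximalRealSubfield L)) L (IsCMField.complexConj L) 2).Adelic) [νG.IsHaarMeasure]
    {h : (quasiSplit (↥(maximalRealSubfield L)) L (IsCMField.complexConj L) 2).Adelic → ℂ} (hh : Continuous h) (hhs : HasCompactSupport h)
    {φ : (quasiSplit (↥(maximalRealSubfield L)) L (IsCMField.complexConj L) 2).Adelic → ℂ} (hφc : Continuous φ) {M : ℝ} (hφM : ∀ x, ‖φ x‖ ≤ M) {z : ℂ} (hz : 1 < z.re)
    (g : (quasiSplit (↥(maximalRealSubfield L)) L (IsCMField.complexConj L) 2).Adelic) :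
    ∫ y, h y * eisensteinSeriesU (flatSectionU φ z) (g * y) ∂νG =
      eisensteinSeriesU (flatSectionU (fun x => (∫ y, h y * flatSectionU φ z (x * y) ∂νG) * (((borelHeight x : ℝ≥0) : ℝ) : ℂ) ^ (-z)) z) g :=
  integral_mul_eisensteinSeriesU_flatSectionU_eq_of_summable νG hh hhs hφc hφM (by linarith) (summable_borelHeight_rpow_cm_two L hz) g

/-- **`R(h) E(f_z^φ) = E(f_z^{T_{h,z}φ})` ON `U(2,1)_{L∕L⁺}` FOR `2 < Re z`** (★ Godement `summable_borelHeight_rpow_cm_three`). [cite: BernsteinLapid2019, §4 Claim 1 (p. 9)] [cite: MoeglinWaldspurger1995, II.1.5, II.1.7] -/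
theorem integral_mul_eisensteinSeriesU_flatSectionU_eq_cm_three
    [MeasurableSpace (quasiSplit (↥(maximalRealSubfield L)) L (IsCMField.complexConj L) 3).Adelic] [BorelSpace (quasiSplit (↥(maximalRealSubfield L)) L (IsCMField.complexConj L) 3).Adelic]
    (νG : Measure (quasiSplit (↥(maximalRealSubfield L)) L (IsCMField.complexConj L) 3).Adelic) [νG.IsHaarMeasure]
    {h : (quasiSplit (↥(maximalRealSubfield L)) L (IsCMField.complexConj L) 3).Adelic → ℂ} (hh : Continuous h) (hhs : HasCompactSupport h)
    {φ : (quasiSplit (↥(maximalRealSubfield L)) L (IsCMField.complexConj L) 3).Adelic → ℂ} (hφc : Continuous φ) {M : ℝ} (hφM : ∀ x, ‖φ x‖ ≤ M) {z : ℂ} (hz : 2 < z.re)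
    (g : (quasiSplit (↥(maximalRealSubfield L)) L (IsCMField.complexConj L) 3).Adelic) :
    ∫ y, h y * eisensteinSeriesU (flatSectionU φ z) (g * y) ∂νG =
      eisensteinSeriesU (flatSectionU (fun x => (∫ y, h y * flatSectionU φ z (x * y) ∂νG) * (((borelHeight x : ℝ≥0) : ℝ) : ℂ) ^ (-z)) z) g :=
  integral_mul_eisensteinSeriesU_flatSectionU_eq_of_summable νG hh hhs hφc hφM (by linarith) (summable_borelHeight_rpow_cm_three L hz) g

end CM

end Summit.HodgeConjecture.HodgeConjecture.Cruxes.H413.K2E1ChiEisensteinHeckeMatrixU2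

end
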